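import Literature.AlgebraicGeometry.Shioda1982.ExceptionalQuadruplesSweepFiveHundredSixtySevenPartOne
import Literature.AlgebraicGeometry.Shioda1982.ExceptionalQuadruplesSweepFiveHundredSixtySevenPartTwo
import Literature.AlgebraicGeometry.Shioda1982.ExceptionalQuadruplesSweepFiveHundredSixtySevenPartThree
import Literature.AlgebraicGeometry.Shioda1982.ExceptionalQuadruplesSweepFiveHundredSixtySevenPartFour
import Literature.AlgebraicGeometry.Shioda1982.ExceptionalQuadruplesSweepFiveHundredSixtySevenPartFive
import Literature.AlgebraicGeometry.Shioda1982.ExceptionalQuadruplesSweepFiveHundredSixtySevenPartSix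
import Literature.AlgebraicGeometry.Shioda1982.ExceptionalQuadruplesSweepFiveHundredSixtySevenPartSeven
import Literature.AlgebraicGeometry.Shioda1982.ExceptionalQuadruplesSweepFiveHundredSixtySevenPartEight
import Literature.AlgebraicGeometry.Shioda1982.ExceptionalQuadruplesSweepFiveHundredSixtySevenPartNine
import Literature.AlgebraicGeometry.Shioda1982.ExceptionalQuadruplesSweepFiveHundredSixtySevenPartTen
import Literature.AlgebraicGeometry.Shioda1982.ExceptionalQuadruplesSweepFiveHundredSixtySevenPartEleven
import Literature.AlgebraicGeometry.Shioda1982.ExceptionalQuadruplesSweepFiveHundredSixtySevenPartTwelve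
import Literature.AlgebraicGeometry.Shioda1982.ExceptionalQuadruplesSweepFiveHundredSixtySevenPartThirteen
import Literature.AlgebraicGeometry.Shioda1982.ExceptionalQuadruplesSweepFiveHundredSixtySevenPartFourteen
import Literature.AlgebraicGeometry.Shioda1982.ExceptionalQuadruplesSweepFiveHundredSixtySevenPartFifteen
import Literature.AlgebraicGeometry.Shioda1982.ExceptionalQuadruplesSweepFiveHundredSixtySevenPartSixteen
import Literature.AlgebraicGeometry.Shioda1982.ExceptionalQuadruplesSweepFiveHundredSixtySevenPartSeventeen
import Literature.AlgebraicGeometry.Shioda1982.ExceptionalQuadruplesSweepFiveHundredSixtySevenPartEighteen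
import Literature.AlgebraicGeometry.Shioda1982.ExceptionalQuadruplesSweepFiveHundredSixtySevenPartNineteen
import Literature.AlgebraicGeometry.Shioda1982.ExceptionalQuadruplesSweepFiveHundredSixtySevenPartTwenty
import Literature.AlgebraicGeometry.Shioda1982.ExceptionalQuadruplesSweepFiveHundredSixtySevenPartTwentyOne
import Literature.AlgebraicGeometry.Shioda1982.ExceptionalQuadruplesSweepFiveHundredSixtySevenPartTwentyTwo
import Literature.AlgebraicGeometry.Shioda1982.ExceptionalQuadruplesSweepFiveHundredSixtySevenPartTwentyThree
import Literature.AlgebraicGeometry.Shioda1982.ExceptionalQuadruplesSweepFiveHundredSixtySevenPartTwentyFour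
import Literature.AlgebraicGeometry.Shioda1982.ExceptionalQuadruplesSweepFiveHundredSixtySevenPartTwentyFive
import Literature.AlgebraicGeometry.Shioda1982.ExceptionalQuadruplesSweepFiveHundredSixtySevenPartTwentySix
import Literature.AlgebraicGeometry.Shioda1982.ExceptionalQuadruplesSweepFiveHundredSixtySevenPartTwentySeven
import Literature.AlgebraicGeometry.Shioda1982.ExceptionalQuadruplesSweepFiveHundredSixtySevenPartTwentyEight
import Literature.AlgebraicGeometry.Shioda1982.ExceptionalQuadruplesSweepFiveHundredSixtySevenPartTwentyNine
import Literature.AlgebraicGeometry.Shioda1982.ExceptionalQuadruplesSweepFiveHundredSixtySevenPartThirty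
import Literature.AlgebraicGeometry.Shioda1982.ExceptionalQuadruplesSweepFiveHundredSixtySevenPartThirtyOne
import Literature.AlgebraicGeometry.Shioda1982.ExceptionalQuadruplesSweepFiveHundredSixtySevenPartThirtyTwo
import Literature.AlgebraicGeometry.Shioda1982.ExceptionalQuadruplesSweepFiveHundredSixtySevenPartThirtyThree
import Literature.AlgebraicGeometry.Shioda1982.ExceptionalQuadruplesSweepFiveHundredSixtySevenPartThirtyFour
import Literature.AlgebraicGeometry.Shioda1982.ExceptionalQuadruplesSweepFiveHundredSixtySevenPartThirtyFive
import Literature.AlgebraicGeometry.Shioda1982.ExceptionalQuadruplesSweepFiveHundredSixtySevenPartThirtySix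
import HarnessLib

/-!
# Shioda 1982 / Meyer–Neutsch 1981: no exceptional quadruple at the level `N = 567` — kernel sweep, part 37 of 37 and assembly

Topic `Literature/AlgebraicGeometry/Shioda1982`; companion of `ExceptionalQuadruplesComplete.lean` (search `checkB`, soundness
`tabelleOneCompleteAt_of_chunks`, invariant form `exists_mem_reps_of_isExceptionalQuadruple`, statement `TabelleOneCompleteAt`; sources,
method and framing in its module docstring) and of the series `ExceptionalQuadruplesSweep*.lean` (together: every level `2 ≤ N ≤ 180`
that is not a row of Tabelle 1; `…SweepTwoHundredTwenty/…TwoHundredSixty/…ThreeHundredForty.lean`,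
`…SweepTwoHundredFiftyTwo/…ThreeHundredNinetySix/…FourHundredSixtyEight.lean`, `…SweepTwoHundred.lean`: the levels `220, 260, 340`, `252, 396, 468`
and `200` of the families `20p`, `36p`, `40p`; `…Sweep<Level>[Part<K>].lean` for the `{2,3,5,7}`-smooth residual levels
`189, 192, 210, 216, 224, 240, 270, 288, 300, 315, 320, 324, 336, 360, 378, 384, 405, 420, 432, 448` and now `480 … 630`). THEOREMS only (no definition, no named fact): the same kernel
search at the single level `N = 567`, which carries NO row of [MeyerNeutsch1981Fermatquadrupel, Tabelle 1] (computer-generated there,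
"alle Fermatquadrupel für N ≤ 614 ermittelt", §2 p. 53) and lies above the range `N ≤ 180` of Shioda's table p. 727 — by Aoki's
Theorem C ([Aoki1983], computer-assisted for `181 ≤ m ≤ 672`) there is no exceptional element at any level `> 180`; the files
`ExceptionalQuadruplesSweepFiveHundredSixtySevenPartOne.lean`, `ExceptionalQuadruplesSweepFiveHundredSixtySevenPartTwo.lean`, `ExceptionalQuadruplesSweepFiveHundredSixtySevenPartThree.lean`, `ExceptionalQuadruplesSweepFiveHundredSixtySevenPartFour.lean`, `ExceptionalQuadruplesSweepFiveHundredSixtySevenPartFive.lean`, `ExceptionalQuadruplesSweepFiveHundredSixtySevenPartSix.lean`, `ExceptionalQuadruplesSweepFiveHundredSixtySevenPartSeven.lean`, `ExceptionalQuadruplesSweepFiveHundredSixtySevenPartEight.lean`, `ExceptionalQuadruplesSweepFiveHundredSixtySevenPartNine.lean`, `ExceptionalQuadruplesSweepFiveHundredSixtySevenPartTen.lean`, `ExceptionalQuadruplesSweepFiveHundredSixtySevenPartEleven.lean`, `ExceptionalQuadruplesSweepFiveHundredSixtySevenPartTwelve.lean`, `ExceptionalQuadruplesSweepFiveHundredSixtySevenPartThirteen.lean`,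 `ExceptionalQuadruplesSweepFiveHundredSixtySevenPartFourteen.lean`, `ExceptionalQuadruplesSweepFiveHundredSixtySevenPartFifteen.lean`, `ExceptionalQuadruplesSweepFiveHundredSixtySevenPartSixteen.lean`, `ExceptionalQuadruplesSweepFiveHundredSixtySevenPartSeventeen.lean`, `ExceptionalQuadruplesSweepFiveHundredSixtySevenPartEighteen.lean`, `ExceptionalQuadruplesSweepFiveHundredSixtySevenPartNineteen.lean`, `ExceptionalQuadruplesSweepFiveHundredSixtySevenPartTwenty.lean`, `ExceptionalQuadruplesSweepFiveHundredSixtySevenPartTwentyOne.lean`, `ExceptionalQuadruplesSweepFiveHundredSixtySevenPartTwentyTwo.lean`, `ExceptionalQuadruplesSweepFiveHundredSixtySevenPartTwentyThree.lean`, `ExceptionalQuadruplesSweepFiveHundredSixtySevenPartTwentyFour.lean`, `ExceptionalQuadruplesSweepFiveHundredSixtySevenPartTwentyFive.lean`, `ExceptionalQuadruplesSweepFiveHundredSixtySevenPartTwentySix.lean`, `ExceptionalQuadruplesSweepFiveHundredSixtySevenPartTwentySeven.lean`, `ExceptionalQuadruplesSweepFiveHundredSixtySevenPartTwentyEight.lean`,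 `ExceptionalQuadruplesSweepFiveHundredSixtySevenPartTwentyNine.lean`, `ExceptionalQuadruplesSweepFiveHundredSixtySevenPartThirty.lean`, `ExceptionalQuadruplesSweepFiveHundredSixtySevenPartThirtyOne.lean`, `ExceptionalQuadruplesSweepFiveHundredSixtySevenPartThirtyTwo.lean`, `ExceptionalQuadruplesSweepFiveHundredSixtySevenPartThirtyThree.lean`, `ExceptionalQuadruplesSweepFiveHundredSixtySevenPartThirtyFour.lean`, `ExceptionalQuadruplesSweepFiveHundredSixtySevenPartThirtyFive.lean`, `ExceptionalQuadruplesSweepFiveHundredSixtySevenPartThirtySix.lean`, `ExceptionalQuadruplesSweepFiveHundredSixtySeven.lean` make the instance `N = 567` a kernel statement. The search at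
`N = 567` visits 5103685 candidate triples (`φ(567) − 1 = 323` units each), too many for one elaboration of bounded wall time, so the
chunks of first entries are spread over 37 files: `ExceptionalQuadruplesSweepFiveHundredSixtySevenPartOne.lean` — first entries `0 ≤ a < 5` (134881 candidates);
`ExceptionalQuadruplesSweepFiveHundredSixtySevenPartTwo.lean` — first entries `5 ≤ a < 10` (137062 candidates);
`ExceptionalQuadruplesSweepFiveHundredSixtySevenPartThree.lean` — first entries `10 ≤ a < 15` (139014 candidates);
`ExceptionalQuadruplesSweepFiveHundredSixtySevenPartFour.lean` — first entries `15 ≤ a < 20` (140737 candidates);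
`ExceptionalQuadruplesSweepFiveHundredSixtySevenPartFive.lean` — first entries `20 ≤ a < 24` (113676 candidates);
`ExceptionalQuadruplesSweepFiveHundredSixtySevenPartSix.lean` — first entries `24 ≤ a < 29` (143261 candidates);
`ExceptionalQuadruplesSweepFiveHundredSixtySevenPartSeven.lean` — first entries `29 ≤ a < 34` (144342 candidates);
`ExceptionalQuadruplesSweepFiveHundredSixtySevenPartEight.lean` — first entries `34 ≤ a < 39` (145194 candidates);
`ExceptionalQuadruplesSweepFiveHundredSixtySevenPartNine.lean` — first entries `39 ≤ a < 43` (116615 candidates);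
`ExceptionalQuadruplesSweepFiveHundredSixtySevenPartTen.lean` — first entries `43 ≤ a < 48` (146150 candidates);
`ExceptionalQuadruplesSweepFiveHundredSixtySevenPartEleven.lean` — first entries `48 ≤ a < 53` (146361 candidates);
`ExceptionalQuadruplesSweepFiveHundredSixtySevenPartTwelve.lean` — first entries `53 ≤ a < 58` (146342 candidates);
`ExceptionalQuadruplesSweepFiveHundredSixtySevenPartThirteen.lean` — first entries `58 ≤ a < 62` (116906 candidates);
`ExceptionalQuadruplesSweepFiveHundredSixtySevenPartFourteen.lean` — first entries `62 ≤ a < 67` (145731 candidates);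
`ExceptionalQuadruplesSweepFiveHundredSixtySevenPartFifteen.lean` — first entries `67 ≤ a < 72` (145070 candidates);
`ExceptionalQuadruplesSweepFiveHundredSixtySevenPartSixteen.lean` — first entries `72 ≤ a < 77` (144181 candidates);
`ExceptionalQuadruplesSweepFiveHundredSixtySevenPartSeventeen.lean` — first entries `77 ≤ a < 81` (114550 candidates);
`ExceptionalQuadruplesSweepFiveHundredSixtySevenPartEighteen.lean` — first entries `81 ≤ a < 86` (142002 candidates);
`ExceptionalQuadruplesSweepFiveHundredSixtySevenPartNineteen.lean` — first entries `86 ≤ a < 91` (140471 candidates);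
`ExceptionalQuadruplesSweepFiveHundredSixtySevenPartTwenty.lean` — first entries `91 ≤ a < 96` (138710 candidates);
`ExceptionalQuadruplesSweepFiveHundredSixtySevenPartTwentyOne.lean` — first entries `96 ≤ a < 101` (136721 candidates);
`ExceptionalQuadruplesSweepFiveHundredSixtySevenPartTwentyTwo.lean` — first entries `101 ≤ a < 106` (134502 candidates);
`ExceptionalQuadruplesSweepFiveHundredSixtySevenPartTwentyThree.lean` — first entries `106 ≤ a < 112` (158151 candidates);
`ExceptionalQuadruplesSweepFiveHundredSixtySevenPartTwentyFour.lean` — first entries `112 ≤ a < 117` (128814 candidates);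
`ExceptionalQuadruplesSweepFiveHundredSixtySevenPartTwentyFive.lean` — first entries `117 ≤ a < 122` (125862 candidates);
`ExceptionalQuadruplesSweepFiveHundredSixtySevenPartTwentySix.lean` — first entries `122 ≤ a < 128` (146815 candidates);
`ExceptionalQuadruplesSweepFiveHundredSixtySevenPartTwentySeven.lean` — first entries `128 ≤ a < 134` (141838 candidates);
`ExceptionalQuadruplesSweepFiveHundredSixtySevenPartTwentyEight.lean` — first entries `134 ≤ a < 140` (136465 candidates);
`ExceptionalQuadruplesSweepFiveHundredSixtySevenPartTwentyNine.lean` — first entries `140 ≤ a < 146` (130696 candidates);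
`ExceptionalQuadruplesSweepFiveHundredSixtySevenPartThirty.lean` — first entries `146 ≤ a < 153` (144659 candidates);
`ExceptionalQuadruplesSweepFiveHundredSixtySevenPartThirtyOne.lean` — first entries `153 ≤ a < 160` (135639 candidates);
`ExceptionalQuadruplesSweepFiveHundredSixtySevenPartThirtyTwo.lean` — first entries `160 ≤ a < 168` (143164 candidates);
`ExceptionalQuadruplesSweepFiveHundredSixtySevenPartThirtyThree.lean` — first entries `168 ≤ a < 177` (144827 candidates);
`ExceptionalQuadruplesSweepFiveHundredSixtySevenPartThirtyFour.lean` — first entries `177 ≤ a < 187` (139193 candidates);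
`ExceptionalQuadruplesSweepFiveHundredSixtySevenPartThirtyFive.lean` — first entries `187 ≤ a < 199` (134857 candidates);
`ExceptionalQuadruplesSweepFiveHundredSixtySevenPartThirtySix.lean` — first entries `199 ≤ a < 216` (135809 candidates);
`ExceptionalQuadruplesSweepFiveHundredSixtySeven.lean` — first entries `216 ≤ a < 567` (144417 candidates); the last one assembles
`completeAt_fiveHundredSixtySeven` (every sorted pair-free primitive Hodge 4-multiset mod `567` is standard) and `not_isExceptionalQuadruple_fiveHundredSixtySeven`.
WHY THIS LEVEL (cell `pub-hfermat`): `567 = 3⁴·7`: the tree's character-sum families cover the levels `K·p`, `p` a prime above a bound depending on `K`, for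
`K ∈ {2, 3, 4, 6, 8, 9, 10, 12, 18, 20, 24, 36, 40}` or `K` a power of `2` or of `3` (`PicardNumber<K>Prime.lean`, `PicardNumberTwoPowerPrime.lean`,
`PicardNumberThreePowPrime.lean`) and the prime-power levels (`PicardNumberPrimePower.lean`); writing `567 = K·p` with `p` prime forces
`K ∈ {81, 189}`; `K = 81 = 3⁴` with `p = 7` is below the range `p ≥ 11` of `exceptional_threePowPrime`, the other is not among those `K`. `decide +kernel` only (no `native_decide`).

HONEST FRAMING (cell `pub-hfermat`): explicit algebraic cycles for specific Hodge classes on Fermat/Delsarte varieties; residual open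
instances listed; no claim on general Hodge. These classes are algebraic (Lefschetz (1,1)); certified here is only the emptiness of the
exceptional list at this level.

## References
* [MeyerNeutsch1981Fermatquadrupel] W. Meyer, W. Neutsch, *Fermatquadrupel*, Math. Ann. 256 (1981) 51–62, §2 p. 53, Tabelle 1 p. 54 (no row 567).
* [Shioda1982PicardFermat] T. Shioda, J. Fac. Sci. Univ. Tokyo IA 28 (1982) 725–734, table p. 727 (levels `≤ 180`), Prop. 4 (Q′) p. 729.
* [Aoki1983] N. Aoki, Math. Ann. 266 (1983) 23–54, Thm. C.
-/

namespace Literature.AlgebraicGeometry.Shioda1982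

open Literature.AlgebraicGeometry.HodgeTheory

set_option maxHeartbeats 0 in
/-- **The search at `N = 567` passes on the first entries `216 ≤ a < 567`** (part 37 of 37: 9 chunks, 144417 candidate
triples): every visited sorted quadruple of representatives there fails the Hodge test or is standard (`checkB`; `reps 567 = []`).
[cite: MeyerNeutsch1981Fermatquadrupel, §2 p. 53 ("alle Fermatquadrupel für N ≤ 614 ermittelt") and Tabelle 1 p. 54 (no row 567)]
[cite: Aoki1983, Thm. C] -/
theorem checkB_fiveHundredSixtySeven_partThirtySeven :
    ∀ p ∈ ([(216, 2), (218, 3), (221, 3), (224, 3), (227, 4), (231, 5), (236, 6), (242, 9), (251, 316)] : List (ℕ × ℕ)), checkB 567 p.1 p.2 = true := by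
  intro p hp
  simp only [List.mem_cons, List.not_mem_nil, or_false] at hp
  rcases hp with rfl | rfl | rfl | rfl | rfl | rfl | rfl | rfl | rfl <;> decide +kernel

set_option maxHeartbeats 0 in
/-- **Tabelle 1 is complete at `N = 567`, where it is empty**: every sorted Hodge 4-multiset mod `567` without a pair and with
`gcd = 1` is standard. Kernel exhaustion (`checkB`, 218 chunks of first entries in 37 files, 5103685 candidate triples:
`checkB_fiveHundredSixtySeven_partOne`, `checkB_fiveHundredSixtySeven_partTwo`, `checkB_fiveHundredSixtySeven_partThree`, `checkB_fiveHundredSixtySeven_partFour`, `checkB_fiveHundredSixtySeven_partFive`, `checkB_fiveHundredSixtySeven_partSix`, `checkB_fiveHundredSixtySeven_partSeven`, `checkB_fiveHundredSixtySeven_partEight`, `checkB_fiveHundredSixtySeven_partNine`, `checkB_fiveHundredSixtySeven_partTen`, `checkB_fiveHundredSixtySeven_partEleven`, `checkB_fiveHundredSixtySeven_partTwelve`, `checkB_fiveHundredSixtySeven_partThirteen`, `checkB_fiveHundredSixtySeven_partFourteen`, `checkB_fiveHundredSixtySeven_partFifteen`, `checkB_fiveHundredSixtySeven_partSixteen`,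 `checkB_fiveHundredSixtySeven_partSeventeen`, `checkB_fiveHundredSixtySeven_partEighteen`, `checkB_fiveHundredSixtySeven_partNineteen`, `checkB_fiveHundredSixtySeven_partTwenty`, `checkB_fiveHundredSixtySeven_partTwentyOne`, `checkB_fiveHundredSixtySeven_partTwentyTwo`, `checkB_fiveHundredSixtySeven_partTwentyThree`, `checkB_fiveHundredSixtySeven_partTwentyFour`, `checkB_fiveHundredSixtySeven_partTwentyFive`, `checkB_fiveHundredSixtySeven_partTwentySix`, `checkB_fiveHundredSixtySeven_partTwentySeven`, `checkB_fiveHundredSixtySeven_partTwentyEight`, `checkB_fiveHundredSixtySeven_partTwentyNine`, `checkB_fiveHundredSixtySeven_partThirty`, `checkB_fiveHundredSixtySeven_partThirtyOne`, `checkB_fiveHundredSixtySeven_partThirtyTwo`, `checkB_fiveHundredSixtySeven_partThirtyThree`, `checkB_fiveHundredSixtySeven_partThirtyFour`, `checkB_fiveHundredSixtySeven_partThirtyFive`, `checkB_fiveHundredSixtySeven_partThirtySix`, `checkB_fiveHundredSixtySeven_partThirtySeven`).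
[cite: MeyerNeutsch1981Fermatquadrupel, §2 p. 53 ("alle Fermatquadrupel für N ≤ 614 ermittelt") and Tabelle 1 p. 54 (no row 567)]
[cite: Aoki1983, Thm. C] [cite: Shioda1982PicardFermat, Prop. 4 (Q′) p. 729] -/
theorem completeAt_fiveHundredSixtySeven : TabelleOneCompleteAt 567 :=
  tabelleOneCompleteAt_of_chunks 567 ([(0, 1), (1, 1), (2, 1), (3, 1), (4, 1)] ++ ([(5, 1), (6, 1), (7, 1), (8, 1), (9, 1)] ++ ([(10, 1), (11, 1), (12, 1), (13, 1), (14, 1)] ++ ([(15, 1), (16, 1), (17, 1), (18, 1), (19, 1)] ++ ([(20, 1), (21, 1), (22, 1), (23, 1)] ++ ([(24, 1), (25, 1), (26, 1), (27, 1), (28, 1)] ++ ([(29, 1), (30, 1), (31, 1), (32, 1), (33, 1)] ++ ([(34, 1), (35, 1), (36, 1), (37, 1), (38, 1)] ++ ([(39, 1), (40, 1), (41, 1), (42, 1)] ++ ([(43, 1), (44, 1), (45, 1), (46, 1), (47, 1)] ++ ([(48, 1), (49, 1), (50, 1), (51, 1), (52, 1)] ++ ([(53, 1), (54, 1), (55,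 1), (56, 1), (57, 1)] ++ ([(58, 1), (59, 1), (60, 1), (61, 1)] ++ ([(62, 1), (63, 1), (64, 1), (65, 1), (66, 1)] ++ ([(67, 1), (68, 1), (69, 1), (70, 1), (71, 1)] ++ ([(72, 1), (73, 1), (74, 1), (75, 1), (76, 1)] ++ ([(77, 1), (78, 1), (79, 1), (80, 1)] ++ ([(81, 1), (82, 1), (83, 1), (84, 1), (85, 1)] ++ ([(86, 1), (87, 1), (88, 1), (89, 1), (90, 1)] ++ ([(91, 1), (92, 1), (93, 1), (94, 1), (95, 1)] ++ ([(96, 1), (97, 1), (98, 1), (99, 1), (100, 1)] ++ ([(101, 1), (102, 1), (103, 1), (104, 1), (105, 1)] ++ ([(106, 1), (107, 1), (108, 1), (109, 1), (110, 1), (111, 1)] ++ ([(112, 1), (113, 1), (114, 1), (115, 1), (116, 1)] ++ ([(117, 1), (118, 1), (119, 1), (120, 1), (121, 1)] ++ ([(122, 1), (123, 1), (124, 1), (125, 1), (126, 1), (127, 1)] ++ ([(128, 1), (129, 1), (130, 1), (131, 1), (132, 1), (133, 1)] ++ ([(134, 1), (135, 1), (136, 1), (137, 1), (138, 1), (139,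 1)] ++ ([(140, 1), (141, 1), (142, 1), (143, 1), (144, 1), (145, 1)] ++ ([(146, 1), (147, 1), (148, 1), (149, 1), (150, 1), (151, 1), (152, 1)] ++ ([(153, 1), (154, 1), (155, 1), (156, 1), (157, 1), (158, 1), (159, 1)] ++ ([(160, 1), (161, 1), (162, 1), (163, 1), (164, 1), (165, 1), (166, 1), (167, 1)] ++ ([(168, 1), (169, 1), (170, 1), (171, 1), (172, 1), (173, 1), (174, 1), (175, 1), (176, 1)] ++ ([(177, 1), (178, 1), (179, 1), (180, 1), (181, 1), (182, 1), (183, 1), (184, 1), (185, 1), (186, 1)] ++ ([(187, 1), (188, 1), (189, 1), (190, 1), (191, 1), (192, 1), (193, 1), (194, 1), (195, 1), (196, 1), (197, 1), (198, 1)] ++ ([(199, 1), (200, 1), (201, 1), (202, 2), (204, 2), (206, 2), (208, 2), (210, 2), (212, 2), (214, 2)] ++ ([(216, 2), (218, 3), (221, 3), (224, 3), (227, 4), (231, 5), (236, 6), (242, 9), (251, 316)]))))))))))))))))))))))))))))))))))))) (by decide +kernel) (by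
    intro p hp
    rcases List.mem_append.mp hp with hp | hp
    · exact checkB_fiveHundredSixtySeven_partOne p hp
    · rcases List.mem_append.mp hp with hp | hp
      · exact checkB_fiveHundredSixtySeven_partTwo p hp
      · rcases List.mem_append.mp hp with hp | hp
        · exact checkB_fiveHundredSixtySeven_partThree p hp
        · rcases List.mem_append.mp hp with hp | hp
          · exact checkB_fiveHundredSixtySeven_partFour p hp
          · rcases List.mem_append.mp hp with hp | hp
            · exact checkB_fiveHundredSixtySeven_partFive p hp
            · rcases List.mem_append.mp hp with hp | hp
              · exact checkB_fiveHundredSixtySeven_partSix p hp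
              · rcases List.mem_append.mp hp with hp | hp
                · exact checkB_fiveHundredSixtySeven_partSeven p hp
                · rcases List.mem_append.mp hp with hp | hp
                  · exact checkB_fiveHundredSixtySeven_partEight p hp
                  · rcases List.mem_append.mp hp with hp | hp
                    · exact checkB_fiveHundredSixtySeven_partNine p hp
                    · rcases List.mem_append.mp hp with hp | hp
                      · exact checkB_fiveHundredSixtySeven_partTen p hp
                      · rcases List.mem_append.mp hp with hp | hp
                        · exact checkB_fiveHundredSixtySeven_partEleven p hp
                        · rcases List.mem_append.mp hp with hp | hp
                          · exact checkB_fiveHundredSixtySeven_partTwelve p hp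
                          · rcases List.mem_append.mp hp with hp | hp
                            · exact checkB_fiveHundredSixtySeven_partThirteen p hp
                            · rcases List.mem_append.mp hp with hp | hp
                              · exact checkB_fiveHundredSixtySeven_partFourteen p hp
                              · rcases List.mem_append.mp hp with hp | hp
                                · exact checkB_fiveHundredSixtySeven_partFifteen p hp
                                · rcases List.mem_append.mp hp with hp | hp
                                  · exact checkB_fiveHundredSixtySeven_partSixteen p hp
                                  · rcases List.mem_append.mp hp with hp | hp
                                    · exact checkB_fiveHundredSixtySeven_partSeventeen p hp
                                    · rcases List.mem_append.mp hp with hp | hp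
                                      · exact checkB_fiveHundredSixtySeven_partEighteen p hp
                                      · rcases List.mem_append.mp hp with hp | hp
                                        · exact checkB_fiveHundredSixtySeven_partNineteen p hp
                                        · rcases List.mem_append.mp hp with hp | hp
                                          · exact checkB_fiveHundredSixtySeven_partTwenty p hp
                                          · rcases List.mem_append.mp hp with hp | hp
                                            · exact checkB_fiveHundredSixtySeven_partTwentyOne p hp
                                            · rcases List.mem_append.mp hp with hp | hp
                                              · exact checkB_fiveHundredSixtySeven_partTwentyTwo p hp
                                              · rcases List.mem_append.mp hp with hp | hp
                                                · exact checkB_fiveHundredSixtySeven_partTwentyThree p hp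
                                                · rcases List.mem_append.mp hp with hp | hp
                                                  · exact checkB_fiveHundredSixtySeven_partTwentyFour p hp
                                                  · rcases List.mem_append.mp hp with hp | hp
                                                    · exact checkB_fiveHundredSixtySeven_partTwentyFive p hp
                                                    · rcases List.mem_append.mp hp with hp | hp
                                                      · exact checkB_fiveHundredSixtySeven_partTwentySix p hp
                                                      · rcases List.mem_append.mp hp with hp | hp
                                                        · exact checkB_fiveHundredSixtySeven_partTwentySeven p hp
                                                        · rcases List.mem_append.mp hp with hp | hp
                                                          · exact checkB_fiveHundredSixtySeven_partTwentyEight p hp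
                                                          · rcases List.mem_append.mp hp with hp | hp
                                                            · exact checkB_fiveHundredSixtySeven_partTwentyNine p hp
                                                            · rcases List.mem_append.mp hp with hp | hp
                                                              · exact checkB_fiveHundredSixtySeven_partThirty p hp
                                                              · rcases List.mem_append.mp hp with hp | hp
                                                                · exact checkB_fiveHundredSixtySeven_partThirtyOne p hp
                                                                · rcases List.mem_append.mp hp with hp | hp
                                                                  · exact checkB_fiveHundredSixtySeven_partThirtyTwo p hp
                                                                  · rcases List.mem_append.mp hp with hp | hp
                                                                    · exact checkB_fiveHundredSixtySeven_partThirtyThree p hp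
                                                                    · rcases List.mem_append.mp hp with hp | hp
                                                                      · exact checkB_fiveHundredSixtySeven_partThirtyFour p hp
                                                                      · rcases List.mem_append.mp hp with hp | hp
                                                                        · exact checkB_fiveHundredSixtySeven_partThirtyFive p hp
                                                                        · rcases List.mem_append.mp hp with hp | hp
                                                                          · exact checkB_fiveHundredSixtySeven_partThirtySix p hp
                                                                          · exact checkB_fiveHundredSixtySeven_partThirtySeven p hp)

/-- **No exceptional quadruple ("Ausnahmequadrupel") at the level `567`** (`tabelleOne 567 = []`).
[cite: MeyerNeutsch1981Fermatquadrupel, Tabelle 1 p. 54 (no row 567)] [cite: Aoki1983, Thm. C] -/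
theorem not_isExceptionalQuadruple_fiveHundredSixtySeven (s : Multiset (ZMod 567)) : ¬ IsExceptionalQuadruple 567 s := by
  intro hs
  obtain ⟨r, hr, -⟩ := exists_mem_reps_of_isExceptionalQuadruple completeAt_fiveHundredSixtySeven hs
  simp [reps, tabelleOne] at hr

end Literature.AlgebraicGeometry.Shioda1982
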